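import Summits.HodgeConjecture.HodgeConjecture.Theorems.F0P2pPrincipalSeriesUniqueSub
import Summits.HodgeConjecture.HodgeConjecture.Theorems.F0P2oPrincipalSeriesUniqueIrrSub        -- ★ p831178 (F0P2-p02 (g6)): generic `areIsomorphicRep_of_intertwiningMap_normalizedInd_ne_zero`
import Literature.NumberTheory.Automorphic.U3PrincipalSeriesJacquetFiltrationFullUnfold       -- ★ p831282 (F0P2-p06 (g0)): `U3PrincipalSeriesJacquetFiltration_iff` (N1 ↔ its body, theorem-world)
import Summits.HodgeConjecture.HodgeConjecture.Theorems.F0P2nBorelCharactersUnipotent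
import Literature.NumberTheory.Automorphic.U3PrincipalSeriesJacquetFiltration
import Literature.NumberTheory.Automorphic.UnitaryGroupUnipotentLimitCompactOpen
import Literature.NumberTheory.Automorphic.UnitaryGroupPrincipalSeriesExponents
import Literature.NumberTheory.Rogawski1990.CMLocalAPacketMembers
import Literature.NumberTheory.Automorphic.Liu2021.LemD1AsPrinted
import HarnessLib

/-!
# Sub-uniqueness in the principal series `i_G(χ)`, `χ ≠ wχ` — the CM head over letter N1 (road (T) «UP THE TOWER», step (4))

Crux `stmt-HodgeConjecture-24833` (H413), booked row U1-DISJOINT of cell pub/hodgecm-mathlib F0∕P2: the binder `h4` of ★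
`F0P2oU1DisjointOfTower.u1Disjoint_of_letters` ∕ ★ `F0P2oU1LetterOfTower.u1ThetaDichotomy_nonsplit_of_uniqueSub` (text fixed on the P2 bus
2026-08-31 16:23:35Z), supplied from the named fact N1 ★ `UnitaryGroup.U3PrincipalSeriesJacquetFiltration` [Casselman1995, L. 7.1.1 (a)]:

`principalSeries_uniqueSub (hN1 : ∀ L …, U3PrincipalSeriesJacquetFiltration L) : ‹h4›` — at a non-split finite place `v` of `L⁺`, for
continuous `χ = (χ₁, χ₂)` with `χ ≠ wχ`, any two irreducible smooth representations of `U(Φ₃)(L⁺_v)` admitting NON-ZERO maps into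
`i_G(χ) = cmPrincipalSeries L 3 v (cmTorusCharPair L v χ₁ χ₂)` are isomorphic (`Liu2021.AreIsomorphicRep`).

Proof = the generic theorem ★ `F0P2pPrincipalSeriesUniqueSub.equiv_of_eigenfunctionals` [BernsteinZelevinsky1977, Thm. 2.9, §2.3;
Casselman1995, Thm. 3.2.4] at `t := cmBorelTriple L 3 v`, fed with: the Jacquet data of N1 (finite-dimensionality, `dim = 2`, the
`wχ`-line); `N = ⋃ compact opens` (★ `UnitaryGroup.isLimitOfCompactOpen_cmBorelTriple_N`); `δ_B|_N = 1` (★ `rootDeltaChar_cmBorel_eq_one`);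
smoothness of `i_G(χ)`;
the `(B, χδ_B^{1/2})`-eigenfunctionals `w ↦ (Φᵢ w)(1)` (Frobenius reciprocity, ★ `Representation.frobeniusMap`, §1); and `m₀` with
`χ m₀ ≠ wχ m₀` from `χ ≠ wχ`.

EDITIONS.  ED. 1 = B-p18 (g28) ★ p832406 (the composition restored below); ED. 2 = p832559 (F0P2-p01: same head, proof by
unification-seeding over ★ `equiv_of_eigenfunctionals`, 433 s, plus the two generic lemmas of §1); ED. 3 (this file) = ED. 2's §1 kept,
the head's PROOF restored to ED. 1's 50-second composition of ★ p831178 (F0P2-p02 (g6)) and ★ p831282 (F0P2-p06 (g0)).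

Elaboration note (ED. 2's proof, kept for the record).  N1 is a `def … : Prop`; its body carries abstracted instance proofs (`U3PrincipalSeriesJacquetFiltration._proof_k`)
where theorem-world terms carry the instances themselves, so N1's Jacquet data must not be RE-ASCRIBED to freshly elaborated types (each
such ascription costs the elaborator > 2·10⁶ heartbeats; see ★ `U3PrincipalSeriesJacquetFiltrationUnfold`).  Below, N1's five data are passed
to the generic theorem FIRST, so that its implicit carrier∕instance arguments are assigned from N1's own terms by first-order unification, and
only the small-typed inputs (`Φᵢ`, smoothness, the eigen-laws) meet them.

## References
[Casselman1995] L. 7.1.1 (a) p. 67, Thm. 3.2.4, §6.3 · [BernsteinZelevinsky1977] §2.3, Thm. 2.9 · [BernsteinZelevinsky1976] Prop. 2.28 ·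
[Rogawski1990] §12.2 pp. 173–174.
-/

set_option autoImplicit false
-- the mandated namespace has the single-problem summit's repeated segment (`HodgeConjecture.HodgeConjecture`)
set_option linter.dupNamespace false

noncomputable section

open NumberField IsDedekindDomain
open Literature.NumberTheory Literature.NumberTheory.Automorphic Literature.NumberTheory.Automorphic.UnitaryGroup
open Literature.NumberTheory.Automorphic.Liu2021 Literature.NumberTheory.Rogawski1990

namespace Summit.HodgeConjecture.HodgeConjecture.Cruxes.H413.F0P2pPrincipalSeriesUniqueSubCM

open F0P2pPrincipalSeriesUniqueSub

/-! ## §1 Generic: the eigenfunctional of an intertwiner into `i_P^G χ`; `Representation.Equiv ⇒ AreIsomorphicRep` -/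

section Generic

variable {G : Type*} [Group G] [TopologicalSpace G] [IsTopologicalGroup G] (t : ParabolicTriple G) [LocallyCompactSpace t.P]
  {V : Type*} [AddCommGroup V] [Module ℂ V]

/-- **Frobenius reciprocity, the other direction.**  For a smooth `π` and a NON-ZERO intertwiner `Φ : π → i_P^G χ` (`χ` a character
of `M`), the functional `ℓ w := (Φ w)(1)` (★ `Representation.frobeniusMap`) is non-zero and satisfies
`ℓ (π p w) = χ (proj p) · δ_P^{1/2}(p) · ℓ w` for `p ∈ P`. [cite: BernsteinZelevinsky1976, Proposition 2.28] [cite: BernsteinZelevinsky1977, §2.3] -/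
theorem exists_functional_of_intertwiningMap_normalizedInd_character (χ : t.M →* ℂˣ) (π : Representation ℂ G V)
    (Φ : π.IntertwiningMap (Representation.normalizedInd t ((Representation.trivial ℂ t.M ℂ).twist χ))) (hΦ : Φ ≠ 0)
    (hπ : π.IsSmooth) :
    ∃ ℓ : V →ₗ[ℂ] ℂ, ℓ ≠ 0 ∧
      ∀ (p : t.P) (w : V), ℓ (π p w) = ((χ (t.proj p) : ℂˣ) : ℂ) * ((rootDeltaChar t.P p : ℂˣ) : ℂ) * ℓ w := by
  refine ⟨(Representation.frobeniusMap t.P _ π Φ).toLinearMap, fun h0 => hΦ ?_, fun p w => ?_⟩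
  · have hF : Representation.frobeniusMap t.P _ π Φ = 0 :=
      Representation.IntertwiningMap.ext h0
    rw [← Representation.frobeniusInv_frobeniusMap hπ Φ, hF]
    exact map_zero (Representation.frobeniusEquiv hπ).symm
  · rw [Representation.IntertwiningMap.toLinearMap_apply, Representation.IntertwiningMap.toLinearMap_apply,
      Representation.frobeniusMap_apply, Representation.frobeniusMap_apply]
    have h1 := congrArg (fun f : Representation.SmoothInd t.P _ => f.toFun 1)
      (Representation.IntertwiningMap.isIntertwining _ _ Φ p w)
    refine h1.trans ?_
    have h2 := Representation.SmoothInd.toFun_subgroup_mul (Φ w) p 1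
    rw [mul_one] at h2
    change (Representation.smoothIndRep t.P _ (p : G) (Φ w)).toFun 1 = _
    rw [Representation.toFun_smoothIndRep_apply, one_mul, h2]
    exact F0P2nFrobeniusFunctional.twist_comp_proj_character_apply t χ p _

omit [TopologicalSpace G] [IsTopologicalGroup G] in
/-- A `Representation.Equiv` is an isomorphism in the sense of ★ `Liu2021.AreIsomorphicRep`. [cite: Liu2021, App. D Lemma D.1 (2)–(4)] -/
theorem areIsomorphicRep_of_equiv {V₁ V₂ : Type*} [AddCommGroup V₁] [Module ℂ V₁] [AddCommGroup V₂] [Module ℂ V₂]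
    {π₁ : Representation ℂ G V₁} {π₂ : Representation ℂ G V₂} (e : π₁.Equiv π₂) : AreIsomorphicRep π₁ π₂ :=
  ⟨e.toLinearEquiv, fun g x => by
    rw [Representation.Equiv.toLinearEquiv_apply, Representation.Equiv.toLinearEquiv_apply]
    exact Representation.IntertwiningMap.isIntertwining _ _ e.toIntertwiningMap g x⟩

end Generic

/-! ## §2 The CM head: binder `h4` of the Tower assembly, over N1 -/

set_option synthInstance.maxHeartbeats 400000 in
set_option maxHeartbeats 8000000 in
/-- **ROAD (T) STEP (4) — SUB-UNIQUENESS IN `i_G(χ)` FOR `χ ≠ wχ`, from letter N1** (the binder `h4` of ★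
`F0P2oU1DisjointOfTower.u1Disjoint_of_letters`, text of the P2 bus 2026-08-31 16:23:35Z, VERBATIM).  At a non-split finite place `v` of `L⁺`,
for continuous characters `χ₁` of `L_v^×` and `χ₂` of `E¹_v` with `χ = cmTorusCharPair L v χ₁ χ₂ ≠ wχ = cmWeylTorusCharPair L v χ₁ χ₂`, two
irreducible smooth representations `π₁`, `π₂` of `U(Φ₃)(L⁺_v) = Gqs L v` with non-zero intertwiners into `i_G(χ)` are isomorphic: both are
isomorphic to the unique irreducible subrepresentation of `i_G(χ)` — by exactness of the Jacquet functor, `δ_B|_N = 1`, Frobenius reciprocity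
and N1's description of `r_B i_G(χ)` (dimension `2`, a `wχ`-line, `χ ≠ wχ`), via ★ `equiv_of_eigenfunctionals`.
[cite: Casselman1995, Lemma 7.1.1 (a) p. 67; Thm. 3.2.4] [cite: BernsteinZelevinsky1977, §2.3, Thm. 2.9] [cite: Rogawski1990, §12.2 pp. 173–174] -/
theorem principalSeries_uniqueSub
    (hN1 : ∀ (L : Type) [Field L] [NumberField L] [IsCMField L], UnitaryGroup.U3PrincipalSeriesJacquetFiltration L) :
    ∀ (L : Type) [Field L] [NumberField L] [IsCMField L] (v : HeightOneSpectrum (𝓞 ↥(maximalRealSubfield L))),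
      (∀ w : PlacesOver L v, IsCMField.complexConj L • w.1 = w.1) →
      ∀ (χ₁ : (UnitaryGroup.LocalRing L v)ˣ →* ℂˣ) (χ₂ : ↥(normOneUnits (conjLocal L (IsCMField.complexConj L) v)) →* ℂˣ),
        (Continuous fun x => ((χ₁ x : ℂˣ) : ℂ)) → (Continuous fun x => ((χ₂ x : ℂˣ) : ℂ)) →
        cmTorusCharPair L v χ₁ χ₂ ≠ cmWeylTorusCharPair L v χ₁ χ₂ →
        ∀ {V₁ V₂ : Type} [AddCommGroup V₁] [Module ℂ V₁] [AddCommGroup V₂] [Module ℂ V₂]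
          (π₁ : Representation ℂ (Gqs L v) V₁) (π₂ : Representation ℂ (Gqs L v) V₂),
          π₁.IsIrreducible → π₁.IsSmooth → π₂.IsIrreducible → π₂.IsSmooth →
          haveI := locallyCompactSpace_cmBorelU L 3 v
          ∀ (Φ₁ : π₁.IntertwiningMap (cmPrincipalSeries L 3 v (cmTorusCharPair L v χ₁ χ₂)))
            (Φ₂ : π₂.IntertwiningMap (cmPrincipalSeries L 3 v (cmTorusCharPair L v χ₁ χ₂))),
            Φ₁ ≠ 0 → Φ₂ ≠ 0 → AreIsomorphicRep π₁ π₂ := by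
  -- proof = B-p18 (g28)'s ★ p832406 composition, restored verbatim (ED. 3): N1 is opened through the theorem-world bridge
  -- ★ `U3PrincipalSeriesJacquetFiltration_iff` (p831282) and fed, data first, to ★ `areIsomorphicRep_of_intertwiningMap_normalizedInd_ne_zero`
  -- (p831178); the seeding proof of ED. 2 (p832559, same statement, 433 s) is superseded by this 50-s one.
  intro L _ _ _ v hns χ₁ χ₂ h1c h2c hne V₁ V₂ _ _ _ _ π₁ π₂ hπ₁ _ hπ₂ _ Φ₁ Φ₂ hΦ₁ hΦ₂
  obtain ⟨hfd, h2, ℓ, hℓ1, hℓ, hq⟩ := (UnitaryGroup.U3PrincipalSeriesJacquetFiltration_iff L).1 (hN1 L) v hns χ₁ χ₂ h1c h2c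
  exact @F0P2oPrincipalSeriesUniqueIrrSub.areIsomorphicRep_of_intertwiningMap_normalizedInd_ne_zero (_) (_) (_) (_)
    (cmBorelTriple L 3 v) (_) (isLimitOfCompactOpen_cmBorelTriple_N L 3 v) (cmTorusCharPair L v χ₁ χ₂) (cmWeylTorusCharPair L v χ₁ χ₂) hne
    (F0P2nBorelCharactersUnipotent.deltaChar_cmBorel_eq_one L v) hfd h2 ℓ hℓ1 hℓ hq V₁ V₂ (_) (_) (_) (_) π₁ π₂ hπ₁ hπ₂ Φ₁ Φ₂ hΦ₁ hΦ₂

end Summit.HodgeConjecture.HodgeConjecture.Cruxes.H413.F0P2pPrincipalSeriesUniqueSubCM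

end
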